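import Mathlib
import Summits.Ventures.PercRepro.TriangleCapTopValues

/-!
# PercRepro — EXPLICIT `k`-REGIMES FOR THE TOP VALUES OF THE `K₄⁻`-FREE CHERRY TABLE (p3, gen 50; part 224)

The top-values theorems of parts 214–223 carry the hypothesis «the bipartite gap is below the non-bipartite gap»
(`… ≤ stabGapFull k a r`).  Here it is discharged by an explicit bound on `k`: for `3 ≤ a` the non-bipartite gap
satisfies `stabGapFull k a r ≥ 4 (r − 3) + 2` once `2 a + 2 r ≤ k` (`stabGapFull_ge_four`), `≥ 6 (r − 4)` once
`2 a + 3 r ≤ k` (`stabGapFull_ge_six`), `≥ 8 (r − 5)` once `2 a + 4 r ≤ k` (`stabGapFull_ge_eight`) — in every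
regime of the table (`2 (k − 2a − 1)(a − r)` for `r ≤ a − 3`, `2 (k − 2a − 1)` for `r ∈ {a − 2, a − 1}`, the `min` of
the broom and one-triangle gaps for `r ≥ a`).  `cherry_top_five_of_k`: on every cell with `3 ≤ a`, `6 ≤ r`,
`2 a + 2 r ≤ k` a `K₄⁻`-free graph within `4 (r − 3) + 2` of the closed form sits at one of the five top values.

Axioms: standard.
-/

namespace PercRepro

namespace TriangleCap

namespace C047

open Finset

/-- `stabGapFull k a r ≥ 4 (r − 3) + 2` for `3 ≤ a`, `1 ≤ r`, `2 a + 2 r ≤ k`. -/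
theorem stabGapFull_ge_four (k a r : ℕ) (ha3 : 3 ≤ a) (hr : 1 ≤ r) (hk : 2 * a + 2 * r ≤ k) :
    4 * (r - 3) + 2 ≤ stabGapFull k a r := by
  unfold stabGapFull
  by_cases h1 : r + 3 ≤ a
  · rw [if_pos h1]
    have hb1 : 2 * r - 1 ≤ k - 2 * a - 1 := by omega
    have hb2 : 3 ≤ a - r := by omega
    have := Nat.mul_le_mul (Nat.mul_le_mul_left 2 hb1) hb2
    omega
  · rw [if_neg h1]
    by_cases h2 : r + 1 ≤ a
    · rw [if_pos h2]
      omega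
    · rw [if_neg h2]
      apply le_min
      · have : 0 ≤ 2 * (r - a) * (a - 2) := Nat.zero_le _
        omega
      · have : 0 ≤ 2 * (r - a) * (a - 3) := Nat.zero_le _
        omega

/-- `stabGapFull k a r ≥ 6 (r − 4)` for `3 ≤ a`, `1 ≤ r`, `2 a + 3 r ≤ k`. -/
theorem stabGapFull_ge_six (k a r : ℕ) (ha3 : 3 ≤ a) (hr : 1 ≤ r) (hk : 2 * a + 3 * r ≤ k) :
    6 * (r - 4) ≤ stabGapFull k a r := by
  unfold stabGapFull
  by_cases h1 : r + 3 ≤ a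
  · rw [if_pos h1]
    have hb1 : 3 * r - 1 ≤ k - 2 * a - 1 := by omega
    have hb2 : 3 ≤ a - r := by omega
    have := Nat.mul_le_mul (Nat.mul_le_mul_left 2 hb1) hb2
    omega
  · rw [if_neg h1]
    by_cases h2 : r + 1 ≤ a
    · rw [if_pos h2]
      omega
    · rw [if_neg h2]
      apply le_min
      · have : 0 ≤ 2 * (r - a) * (a - 2) := Nat.zero_le _
        omega
      · have : 0 ≤ 2 * (r - a) * (a - 3) := Nat.zero_le _
        omega

/-- `stabGapFull k a r ≥ 8 (r − 5)` for `3 ≤ a`, `1 ≤ r`, `2 a + 4 r ≤ k`. -/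
theorem stabGapFull_ge_eight (k a r : ℕ) (ha3 : 3 ≤ a) (hr : 1 ≤ r) (hk : 2 * a + 4 * r ≤ k) :
    8 * (r - 5) ≤ stabGapFull k a r := by
  unfold stabGapFull
  by_cases h1 : r + 3 ≤ a
  · rw [if_pos h1]
    have hb1 : 4 * r - 1 ≤ k - 2 * a - 1 := by omega
    have hb2 : 3 ≤ a - r := by omega
    have := Nat.mul_le_mul (Nat.mul_le_mul_left 2 hb1) hb2
    omega
  · rw [if_neg h1]
    by_cases h2 : r + 1 ≤ a
    · rw [if_pos h2]
      omega
    · rw [if_neg h2]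
      apply le_min
      · have : 0 ≤ 2 * (r - a) * (a - 2) := Nat.zero_le _
        omega
      · have : 0 ≤ 2 * (r - a) * (a - 3) := Nat.zero_le _
        omega

/-- **THE TOP FIVE VALUES IN AN EXPLICIT `k`-REGIME:** for `3 ≤ a`, `6 ≤ r`, `2 a + 2 r ≤ k`, a `K₄⁻`-free graph on the
cell within `4 (r − 3) + 2` of the closed form sits at one of `closed`, `closed − 2 (r − 2)`, `closed − 2 (r − 1)`,
`closed − 4 (r − 3)`, `closed − (4 (r − 3) + 2)`, and each of the five is attained. -/
theorem cherry_top_five_of_k (k a r : ℕ) (ha3 : 3 ≤ a) (hr6 : 6 ≤ r) (hk : 2 * a + 2 * r ≤ k) :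
    (∀ (D : SimpleGraph (Fin k)) [DecidableRel D.Adj], K4mFree D → D.edgeFinset.card + r = a * (k - a) →
        D.edgeFinset.card * k ≤ ∑ v, deg D v * deg D v + r * (k - 1 - r) + (4 * (r - 3) + 2) →
        ∑ v, deg D v * deg D v + r * (k - 1 - r) = D.edgeFinset.card * k ∨
        ∑ v, deg D v * deg D v + r * (k - 1 - r) + 2 * (r - 2) = D.edgeFinset.card * k ∨
        ∑ v, deg D v * deg D v + r * (k - 1 - r) + 2 * (r - 1) = D.edgeFinset.card * k ∨
        ∑ v, deg D v * deg D v + r * (k - 1 - r) + 4 * (r - 3) = D.edgeFinset.card * k ∨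
        ∑ v, deg D v * deg D v + r * (k - 1 - r) + (4 * (r - 3) + 2) = D.edgeFinset.card * k) ∧
      (∀ g ∈ ({0, 2 * (r - 2), 2 * (r - 1), 4 * (r - 3), 4 * (r - 3) + 2} : Finset ℕ),
        ∃ (D : SimpleGraph (Fin k)) (_ : DecidableRel D.Adj), K4mFree D ∧ D.edgeFinset.card + r = a * (k - a) ∧
          ∑ v, deg D v * deg D v + r * (k - 1 - r) + g = D.edgeFinset.card * k) :=
  cherry_top_five k a r ha3 hr6 (by omega) (fun _ => by omega) (stabGapFull_ge_four k a r ha3 (by omega) hk)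

end C047

end TriangleCap

end PercRepro
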